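import Literature.NumberTheory.Automorphic.Liu2021.Def45AsPrinted
import Literature.AlgebraicGeometry.Motives.ChowCorrespondences
import Literature.AlgebraicGeometry.Motives.BettiRealization
import Literature.AlgebraicGeometry.Motives.AbelianVarietyProjectiveChart
import Mathlib.Algebra.Algebra.Rat
import Mathlib.Algebra.Category.AlgCat.Basic
import Mathlib.Algebra.Category.ModuleCat.Basic
import Mathlib.LinearAlgebra.Eigenspace.Basic
import Mathlib.FieldTheory.IntermediateField.Adjoin.Defs
import Mathlib.Algebra.Polynomial.AlgebraMap
import HarnessLib

/-!
# [Liu 2021] §4.1 «Motives for CM characters» (Camb. J. Math. 9, pp. 41–45) — section carpet, items 4.1–4.10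

Y. Liu, *Fourier–Jacobi cycles and arithmetic relative trace formula*, Cambridge J. Math. **9** (2021), no. 1, 1–147
= arXiv:2102.11518 [Liu2021], §4.1 = print pp. 41 L9 – 45 L22 (held journal text
`paper:liu2021-fourier-jacobi-cycles-arithmetic-relative-trace-formula`, page file pNNNN = journal page N; second locator:
the author's TeX `FJcycle.tex`, md5 `6db49a74122d…`, ll. 1895–2047).  STATEMENTS ONLY (carpet-typing, squad TL «Liu
FJ∕418», seat TL-t01): no proof, no `sorry`, no `axiom`, no `instance`, no notation.  Numbering = journal = arXiv.

## INDEX of §4.1 (every numbered item ↦ the tree declaration that states it; CITED BY NAME, not restated)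

| item (print page; TeX label, lines) | status | declaration(s) |
|---|---|---|
| Def. 4.1 (p. 41; `de:conjugate`, l. 1900) conjugate self-dual ∕ orthogonal ∕ symplectic automorphic character | IN TREE (defs) | `Literature.NumberTheory.Automorphic.IdeleClassGroup.IsConjugateSelfDual`, `….IsConjugateOrthogonal`, `….IsConjugateSymplectic` (file `Automorphic/ConjugateSelfDualCharacters`; `isConjugateSelfDual_iff_mul_conj`) |
| Rem. 4.2 (p. 41; l. 1904) strictly unitary; orthogonal or symplectic, not both; `Φ_μ`, `𝚠_μ`, uniqueness | IN TREE (theorems) | `IdeleClassGroup.IsConjugateSelfDual.isStrictlyUnitary` (`Automorphic/IdeleClassCharacterConjugate`), `IsConjugateSymplectic.not_isConjugateOrthogonal`, `IsConjugateSymplectic.odd`, `IsConjugateOrthogonal.even`, `hasInfinityType_unique` (`ConjugateSelfDualCharacters`), `IsConjugateSelfDual.existsUnique_hasInfinityType`, `IsConjugateSymplectic.exists_hasInfinityType_odd`, `IsConjugateOrthogonal.exists_hasInfinityType_even` (`ConjugateSelfDualInfinityType`), `HasCMType.unique` |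
| Def. 4.3 (p. 41; `de:conjugate2`, l. 1914) weight `𝚠_μ`, «of weight `m`», CM type `Φ_μ`, reflex field `M'_μ`, `Ψ_μ`; `μ^{alg}`, `M_μ` (l. 1928) | IN TREE (defs) | `IdeleClassGroup.HasWeight`, `IdeleClassGroup.HasCMType`, `weight`, `cmTypeOf` (`ConjugateSelfDualCharacters`); `IsConjugateSelfDual.weightOf`, `IsConjugateSymplectic.weightOf`, `IsConjugateSymplectic.cmType` (`ConjugateSelfDualInfinityType`); `IdeleClassGroup.muAlg` (`μ^{alg} = μ·|·|_E^{-1/2}`), `IdeleClassGroup.muAlgValueField` (`M_μ`) (`IdeleClassCharacterAlgebraicTwist`); `M'_μ`, `Ψ_μ` presented as `reflexField ℚ L (algValuedIn ι Φ_μ)`, `reflexCMType ι Φ_μ φ` with `Liu2021.Def45.incl` (`M'_μ ⊆ M_μ`) (`Liu2021/Def45AsPrinted`) |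
| Rem. 4.4 (p. 42; `re:mu`, l. 1930) `μ^c` conjugate symplectic of the same weight; `M_{μ^c} = M_μ`, `M'_{μ^c} = M'_μ`, `Ψ_{μ^c}` opposite | IN TREE (theorems) | `IsConjugateSymplectic.remark44`, `IsConjugateSymplectic.weightOf_galConj`, `IsConjugateSymplectic.cmType_galConj` (`IdeleClassCharacterConjugate`); `IdeleClassGroup.muAlgValueField_galConj_complexConj` (`IdeleClassCharacterAlgebraicTwist`); `Liu2021.Def45.reflexField_algValuedIn_conjugate`, `Liu2021.Def45.inducedCMType_incl_conjugate`, `Liu2021.Def45.eta_conjugate` (`Liu2021/Def45EtaConjugate`) |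
| Def. 4.5 (p. 42; `de:cm_data`, l. 1936) `η'_μ`, `η_μ`, CM data `D_μ = (A_μ, i_μ, λ_μ, r_μ)`, `𝒜(μ)`, `D_μ^∨` | IN TREE (AS PRINTED) | `Liu2021.Def45.etaPrime`, `Liu2021.Def45.eta`, `Liu2021.Def45.Carriers`, `Liu2021.Def45.CMDatum` (`Liu2021/Def45AsPrinted`; + `Def45CMCharacter`, `Def45Polarisation`, `Def45RMuForm`, `Def45LieForm`, …); older typed skeleton `Literature.AlgebraicGeometry.Liu2021.LiuCMData` (`AlgebraicGeometry/Liu2021/CMData`) |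
| Prop. 4.6 (pp. 42–43; `pr:cm_data`, l. 1966) (1) `𝒜(μ)` nonempty connected poset; (2) `𝒜(μ)^{op} ≃ 𝒜(μ^c)` | (1) IN TREE (AS PRINTED); (2) not typed (no consumer; needs the dual datum `D_μ^∨`, a ⟨CARRIER⟩ of `Def45.Carriers`) | `Liu2021.Prop46_1AsPrinted` (+ `Liu2021.Thm418Data.nonempty_obj`, `….zigzag`, `….subsingleton_hom`, `Liu2021.prop46_1AsPrinted_satisfiable`; `Liu2021/Prop46AsPrinted`, over the datum `Liu2021.Thm418Data`), `Prop46NonemptyOfCasselman*` (Casselman's theorem [Shi71, Thm. 6] inputs) |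
| Rem. 4.7 (p. 43; `re:motive`, l. 1990) the motive `L_μ := colim_{D_μ} h^1(D_μ)` | NOT TYPED — «Although we will not use in the main body of the article, we propose the definition …» (p. 43 L30): Grothendieck (homological) motives over `E` with coefficients in `M_μ` are not in the tree (`Literature.AlgebraicGeometry.Motives.ChowMotive` is `ℚ`-Chow only); its one claim («the canonical map `L_μ → h^1(D_μ)` is an isomorphism», from Prop. 4.6 (1)) has no consumer | — |
| p. 44 set-up (l. 2000–2009): `I_μ`, `⟨x⟩`, the eigen-decomposition of `H^{[M_μ:ℚ]-i}_{B,τ'}(A_μ, ℂ)`, `𝕋_μ^{B,τ'}` | TYPED HERE | `ProjectorData` (ED.2: over ★ `ChowCorrespondences` ∕ `BettiHodgeData` ∕ `Corr`), `bettiC` = REAL `H^j_{B,τ'}(A, ℂ)` (★ `bettiCohomology` ⊗ ℂ), `bettiOpC`, `inclQ`, `Emb`, `inclusionEmb`, `I₁`, `eigenvalue`, `ProjectorData.HB`, `ProjectorData.corr`, `ProjectorData.IntegralElement`, `ProjectorData.eigenPiece`, `ProjectorData.BettiDecomposition` (fact), `ProjectorData.IsTB` |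
| Def. 4.8 (p. 44; `de:generator`, l. 2011) `I`-generator; `𝕋^x_μ` | TYPED HERE | `ProjectorData.IsGenerator`, `interpPoly`, `ProjectorData.Tx` |
| p. 44 L–1 – p. 45 L7 (l. 2029): `𝕋^x_μ ∈ CH_{M_μ}`; `cl(𝕋^x_μ) = 𝕋^{B,τ'}_μ`; `𝕋^{num}_μ`; O'Sullivan lift | TYPED HERE (facts) | `ProjectorData.GeneratorExists`, `ProjectorData.TxRational`, `ProjectorData.TxRealisation`, `ProjectorData.TxNumIndependent` |
| Def. 4.9 (p. 45; `de:mu_canonical`, l. 2032) canonical projector `𝕋^{can}_μ` | TYPED HERE | `ProjectorData.Tcan`, `ProjectorData.Def49AsPrinted` (fact) |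
| Lem. 4.10 (p. 45; `le:mu_canonical`, l. 2036) `cl^*_{B,τ'}(𝕋^{can}_μ) = 𝕋^{B,τ'}_μ` | TYPED HERE (fact) | `ProjectorData.Lem410AsPrinted` |

## AS PRINTED — the green-field part (p. 44 L1 – p. 45 L22 = TeX ll. 2000–2047), VERBATIM

«To end this subsection, we construct a certain canonical projector on `A_μ`, which will be used in Subsection 4.3.  Let
`μ` be as in Definition 4.5.  Denote by `I_μ` the set of all complex embeddings of `M_μ`.  We take a CM data
`D_μ = (A_μ, i_μ, λ_μ, r_μ) ∈ 𝒜(μ)` for `μ`.  For every element `x ∈ M_μ` such that `i_μ(x) ∈ End_E(A_μ)`, we denote by `⟨x⟩`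
the correspondence `A_μ ←(i_μ(x))− A_μ −(id)→ A_μ` of `A_μ`.  In particular, `⟨x⟩^* = i_μ(x)_*`.  For every `τ' : E ↪ ℂ`
and every integer `0 ≤ i ≤ [M_μ:ℚ]`, we have a canonical decomposition
  `H^{[M_μ:ℚ]-i}_{B,τ'}(A_μ, ℂ) = ⊕_{I ⊆ I_μ, |I| = i} H^{[M_μ:ℚ]-i}_{B,τ'}(A_μ, ℂ)_I`,
where `H^{[M_μ:ℚ]-i}_{B,τ'}(A_μ, ℂ)_I` denotes the subspace on which `cl^*_{B,τ'}(⟨x⟩)` acts by `∏_{ι ∈ I} ι(x)` for every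
`x ∈ M_μ` satisfying `i_μ(x) ∈ End_E(A_μ)`.  Let `𝕋_μ^{B,τ'}` be the endomorphism of `⊕_i H^i_{B,τ'}(A_μ, ℂ)` such that
 • the restriction `𝕋_μ^{B,τ'} | H^i_{B,τ'}(A_μ, ℂ)` is zero if `i ≠ [M_μ:ℚ] − 1`,
 • the restriction `𝕋_μ^{B,τ'} | H^{[M_μ:ℚ]-1}_{B,τ'}(A_μ, ℂ)` is the canonical projection to the direct summand
   `H^{[M_μ:ℚ]-1}_{B,τ'}(A_μ, ℂ)_{I_1}`, where `I_1 ⊆ I_μ` is the subset consisting only of the inclusion `M_μ ↪ ℂ`.»  (p. 44)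
«**Definition 4.8.** Let `I ⊆ I_μ` be a subset.  (1) We say that `x ∈ M_μ` is an *`I`-generator* if `x` generates the
field `M_μ` with `i_μ(x) ∈ End_E(A_μ)` such that `∏_{ι∈I} ι(x) ≠ ∏_{ι∈J} ι(x)` for every `J ⊆ I_μ` other than `I`.
(2) For an `I`-generator `x`, we put
  `𝕋^x_μ := ∏_{J ≠ I} (⟨x⟩ − ∏_{ι∈J} ι(x)) ⁄ (∏_{ι∈I} ι(x) − ∏_{ι∈J} ι(x)) ∈ CH^{[M_μ:ℚ]/2}(A_μ × A_μ)_ℂ`.»  (p. 44)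
«We now choose an `I_1`-generator `x`.  It is easy to see that `𝕋_μ^x` lies in `CH^{[M_μ:ℚ]/2}(A_μ × A_μ)_{M_μ}`, and moreover
`cl^*_{B,τ'}(𝕋^x_μ) = 𝕋_μ^{B,τ'}`.  In particular, the numerical equivalence class of `𝕋_μ^x` is independent of the choice of
`x`, which we denote by `𝕋_μ^{num}`.  Applying the main theorem of [O'S11]⁴ to `A_μ × A_μ`, we know that `𝕋_μ^{num}` has a
canonical lift in `CH^{[M_μ:ℚ]/2}(A_μ × A_μ)_{M_μ}`, which we denote by `𝕋_μ^{can}`.» (p. 44 L–1 – p. 45 L7; footnote 4, p. 45: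
«The author states the theorem with coefficients in `ℚ`. However, by [O'S11, Corollary 6.2.6], one may replace `ℚ` by any
field of characteristic zero, for example, `M_μ`.»)
«**Definition 4.9.** We call `𝕋_μ^{can} ∈ CH^{[M_μ:ℚ]/2}(A_μ × A_μ)_{M_μ}` the *canonical projector* of `A_μ`.»  (p. 45)
«**Lemma 4.10.** For every `τ' : E ↪ ℂ`, we have `cl^*_{B,τ'}(𝕋_μ^{can}) = 𝕋_μ^{B,τ'}`.»  (p. 45; proof p. 45 L10–22 from
[O'S11] (iii), the decomposition above and an `I^c`-generator — not reproduced: statements only.)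

## The typing (paper order).  REAL = a tree object; DEFINED = defined here; ⟨CARRIER⟩ = posited datum for a printed
object the tree cannot construct (same discipline as `Thm418AsPrinted` ∕ `Def45AsPrinted`); PINNED = a carrier whose meaning is
fixed by fields relating it to REAL ∕ tree objects (ED.2, squad TL retro-audit: T-ref2 (c) P1 «Chow∕corr∕ChowM∕HB∕clB onto
★ ChowCorrespondences ∕ BettiHodgeData», P2 «O'Sullivan spec for canLift»)

* `E` — Liu's CM field (`[NumberField E] [IsCMField E]`, Liu's `E ∕ F = E ∕ E⁺`); `μ : IdeleClassGroup E →ₜ* Circle` with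
  `hμ : IsConjugateSymplectic E μ` and «of weight one» `hw : HasWeight E μ 1` («Let `μ` be as in Definition 4.5», p. 44 L2)
  — REAL.  `M_μ = IdeleClassGroup.muAlgValueField E μ ⊆ ℂ` — REAL (a number field: `hμ.numberField_muAlgValueField`).
* `I_μ` = `Emb μ := M_μ →+* ℂ` — REAL; `I_1 = {inclusion}` = `I₁ μ` — DEFINED; `∏_{ι∈I} ι(x)` = `eigenvalue I x` — DEFINED.
* `(A_μ, i_μ)` — REAL: the fields `A : AbelianVariety E`, `i : M_μ →+* End⁰(A_μ)` of `ProjectorData` are the first two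
  components of an object `D_μ ∈ 𝒜(μ)` (`Liu2021.Def45.CMDatum.A`, `.i`, with «CM structure» read as
  `[M_μ:ℚ] = 2 dim A_μ` = `Def45.CMDatum.finrank_eq`); `λ_μ`, `r_μ` are not used by pp. 44–45.
  «`x ∈ M_μ` such that `i_μ(x) ∈ End_E(A_μ)`» = a witness `f : End A_μ` with `i_μ(x) = 1 ⊗ f` (`IntegralElement`;
  `AbelianVariety.endAlgebra.of`), REAL.
* REAL `HB τ' j = bettiC A_μ τ' j := ℂ ⊗_ℚ H^j(A_μ(ℂ)_{τ'}; ℚ)` — `H^j_{B,τ'}(A_μ, ℂ)`: the tree's rational Betti cohomology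
  ★ `Motives.bettiCohomology` of the complex points of `A_μ` along `τ'` (the `E`-algebra structure `τ'.toAlgebra` on `ℂ`, house
  pattern ★ `AppendixC.algebraAlong` ∕ `bettiH1Along`), tensored with `ℂ`.  The embedding `τ'` VARIES (Lem. 4.10: «for every
  `τ' : E ↪ ℂ`»), so everything Betti is indexed by `τ'`.  (ED.2: formerly a ⟨CARRIER⟩.)
* The tree's hypothesis structures, as FIELDS (ED.2): `CC : Motives.ChowCorrespondences E` (Fulton §16.1 calculus: `comp`,
  `transpose`, `graph` on the REAL ★ `Motives.Corr X Y e = CH_e(X × Y)_ℚ`), `betti τ' : Motives.BettiHodgeData E` along each `τ'`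
  (a Weil cohomology `W` with `W(X) ≅ H^•(X(ℂ)_{τ'}; ℚ)`, cycle classes) and `realisation τ' : CC.Realisation (betti τ').W`
  (cycle classes of products compatible with the calculus).  `A_μ` is smooth projective of dimension `g = dim A_μ` by the
  tree's PROVED ★ `AbelianVariety.isSmoothProjective_holds`, so ★ `WeilCohomology.realize` applies to `Corr A.X A.X g`.
* ⟨CARRIER⟩ `Chow : AlgCat ℂ` — the `ℂ`-algebra `CH^{[M_μ:ℚ]/2}(A_μ × A_μ)_ℂ` of degree-`0` self-correspondences of `A_μ` with
  complex coefficients — PINNED (ED.2): `ofCorr : ℂ ⊗_ℚ Corr A.X A.X g → Chow` is a `ℂ`-linear BIJECTION (`g`-cycles on the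
  `2g`-dimensional `A_μ × A_μ` = codimension `g = [M_μ:ℚ]/2`, `finrank_eq`), multiplicative for `CC.comp` (product `t * s = t ∘ s`,
  Fulton Def. 16.1.1 ∕ Cor. 16.1.1 «an associative ring with unit `[Δ_X]`») and unital (`CC.diag ↦ 1`).  Only the bundling as an
  `AlgCat` object (no instance in this file) is not the tree's own type.
* REAL (over the datum) `corr f = ofCorr (1 ⊗ ᵗΓ_f)` — the class of the correspondence `A_μ ←f− A_μ −id→ A_μ` = the span
  `(f, id)_*[A_μ] = {(f a, a)} = ᵗΓ_f` (Fulton Def. 16.1.1; `CC.graph`, `CC.transpose` on the `E`-morphism underlying `f`); print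
  uses it for `f = i_μ(x)`: `⟨x⟩ = corr f`, and then `⟨x⟩^* = (ᵗᵗΓ_f)_* = (Γ_f)_* = f_*` — «`⟨x⟩^* = i_μ(x)_*`» (p. 44 L5) holds
  by construction.  (ED.2: formerly a ⟨CARRIER⟩.)
* ⟨CARRIER⟩ `ChowM : Subring Chow` with `smul_mem` — the `M_μ`-subalgebra `CH^{[M_μ:ℚ]/2}(A_μ × A_μ)_{M_μ} ⊆ CH(…)_ℂ` — PINNED
  (ED.2) by `coe_ChowM`: its underlying set is the image of `M_μ ⊗_ℚ Corr A.X A.X g` (coefficient extension along `M_μ ⊆ ℂ`,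
  `inclQ`; injective as `ℂ` is flat over `M_μ`).
* ⟨CARRIER⟩ `numTrivial : Submodule ℂ Chow` — the classes numerically equivalent to `0`; the one free dictionary left (numerical
  equivalence needs the degree of `0`-cycles and the intersection product on `A_μ × A_μ`, Fulton Def. 19.1, which
  ★ `ChowCorrespondences` does not offer); its meaning is tied to `symmDist` by `symmDist_unique`.
* ⟨CARRIER⟩ `symmDist : Submodule ℂ Chow` + `canLift : Chow → Chow` with `canLift_sub_mem`, `canLift_eq_of_sub_mem`,
  `canLift_mem`, and (ED.2) `canLift_mem_symmDist`, `symmDist_unique`, `mul_mem_symmDist`, `one_mem_symmDist` — «the main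
  theorem of [O'S11]» ([OSullivan2011], Introduction, Theorem — READ, arXiv:0908.0626 p. 3: «• Above every cycle in
  `\overline{CH}^i(A)_ℚ` there lies a unique symmetrically distinguished cycle in `CH^i(A)_ℚ`. • The symmetrically distinguished
  cycles in `CH^i(A)_ℚ` form a `ℚ`-vector subspace, and the product of symmetrically distinguished cycles … is symmetrically
  distinguished … • For any homomorphism of abelian varieties `f : A → A'`, the pullback `f^*` and push forward `f_*` along `f`
  preserve symmetrically distinguished cycles.»; Thm. 6.2.5 ∕ Cor. 6.2.6 ibid. p. 54 for a general Chow theory with coefficients in a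
  field of characteristic `0` = Liu's footnote 4) applied to the abelian variety `A_μ × A_μ`: `canLift t` is THE symmetrically
  distinguished class in the numerical class of `t` (existence `canLift_sub_mem` + `canLift_mem_symmDist`, uniqueness
  `symmDist_unique`), `symmDist` is closed under composition of correspondences and contains `[Δ]` (bullets 2–3: composition is
  pull-back to `A_μ^3` along projections, product, push-forward along a projection — all homomorphisms).  Multiplicativity of
  `canLift` follows once numerical equivalence is known to be compatible with composition (not posited).
* ⟨CARRIER⟩ `clB τ' j : Chow →ₗ[ℂ] End_ℂ H^j_{B,τ'}(A_μ, ℂ)` — `t ↦ cl^*_{B,τ'}(t)|_{H^j}` on the REAL `bettiC A_μ τ' j`, `ℂ`-linear in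
  `t`, with VALUES PINNED (ED.2) by `clB_ofCorr`: on a rational class `t`, `cl^*_{B,τ'}(t)|_{H^j} = bettiOpC A_μ τ' (betti τ') j (ᵗt)` =
  `ℂ ⊗ (isoObj ∘ ρ_{τ'}(ᵗt)_{j,j} ∘ isoObj⁻¹)`, the tree's cycle-class realisation ★ `WeilCohomology.realize` (`u ↦ γ_ℚ(u)_* =
  pr₂₊(pr₁^* (·) ∪ γ_ℚ(u))`, Kleiman 1968 §1.3, Fulton Ex. 19.2.7) of the transpose (`u^* = (ᵗu)_*`), read on `H^j(A_μ(ℂ)_{τ'}; ℚ)`.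
  Since `ofCorr` is bijective and `clB τ' j` is `ℂ`-linear, `clB` is determined; its anti-multiplicativity `(t ∘ s)^* = s^* ∘ t^*` is a
  consequence of `realisation` (★ `Realisation.realize_comp`, `transpose_comp`) and is deliberately NOT a field (the former
  `→ₐ[ℂ]` typing of `clB` fixed no composition order and is withdrawn).
* DEFINED (real definitions over the datum): `eigenPiece` (`H^j_{B,τ'}(A_μ,ℂ)_I`, an intersection of Mathlib
  `Module.End.eigenspace`s), `IsTB` (the two bullets defining `𝕋^{B,τ'}_μ`, as a predicate on a degree-wise endomorphism),
  `IsGenerator` (Def. 4.8 (1)), `interpPoly` ∕ `Tx` (Def. 4.8 (2): `𝕋^x_μ = P_I^x(⟨x⟩)` with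
  `P_I^x(t) = ∏_{J≠I} (λ_I−λ_J)⁻¹ (t − λ_J) ∈ ℂ[t]`, `λ_J = ∏_{ι∈J} ι(x)` — the printed product of the commuting factors
  `(⟨x⟩−λ_J)/(λ_I−λ_J)` IS the evaluation of the product polynomial at `⟨x⟩`, `Polynomial.aeval`), `Tcan`
  (Def. 4.9: `𝕋^{can}_μ := canLift 𝕋^x_μ`).
* NAMED FACTS (predicates ON the datum `D`; a consumer takes `(h : D.Lem410AsPrinted)` for ITS OWN `D` — `∀ D, …` is not
  the printed statement and is not claimed): `BettiDecomposition` (p. 44), `GeneratorExists` (implicit in «We now choose an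
  `I_1`-generator `x`», p. 44 L–1), `TxRational`, `TxRealisation`, `TxNumIndependent` (p. 44 L–1 – p. 45 L4),
  `Def49AsPrinted`, `Lem410AsPrinted`.  NO PROOFS.

READINGS. R1: `H_I` is cut out by ALL integral `x` (as printed: «for every `x ∈ M_μ` satisfying `i_μ(x) ∈ End_E(A_μ)`»).
R2: «`x` generates the field `M_μ`» = `ℚ(x) = M_μ` (`IntermediateField.adjoin ℚ {x} = ⊤`).  R3: «canonical projection to
the direct summand `H_{I_1}`» of the decomposition `⊕_{|I|=1} H_I` = identity on `H_{I_1}`, zero on `H_I` for `|I| = 1`,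
`I ≠ I_1` (which, given `BettiDecomposition`, determines the endomorphism).  R4: the numerical class `𝕋^{num}_μ` is not a
separate object: «independent of the choice of `x`» is `TxNumIndependent`, and `𝕋^{can}_μ` is `canLift (𝕋^x_μ)` for the
chosen `I_1`-generator `x`, equal for all choices by `canLift_eq_of_sub_mem` (recorded in `Def49AsPrinted`).

## References
* [Liu2021] Y. Liu, Camb. J. Math. 9 (2021) 1–147 = arXiv:2102.11518 — §4.1, pp. 41–45 (TeX ll. 1895–2047).
* [OSullivan2011] = [O'S11] P. O'Sullivan, *Algebraic cycles on an abelian variety*, J. reine angew. Math. 654 (2011) 1–81 =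
  arXiv:0908.0626 — Introduction, Theorem (arXiv p. 3, held text `paper:arxiv-0908.0626` p0003) and Thm. 6.2.5 ∕ Cor. 6.2.6 (p0054),
  READ for the ED.2 pins; cited by [Liu2021] p. 45 L4–7 and footnote 4.
* [Fulton1998] W. Fulton, *Intersection Theory*, §16.1 (Def. 16.1.1, Cor. 16.1.1), Ch. 19 (Def. 19.1, Cor. 19.2, Ex. 19.2.7) — the
  meaning of `Chow`, `corr`, `clB`, via the tree's ★ `Motives/ChowCorrespondences` (whose fields carry these cites).
* [Kleiman1968AlgebraicCycles] S. Kleiman, *Algebraic cycles and the Weil conjectures* (1968), §1.3 — `u ↦ γ(u)_*`, `γ(ᵗΓ_φ)`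
  induces `φ^*` (via ★ `WeilCohomology.realize`, ★ `ChowCorrespondences.Realisation`).
-/

noncomputable section

open NumberField
open Literature.AlgebraicGeometry.Motives (AbelianVariety SchemeOver Corr ChowCorrespondences BettiHodgeData bettiCohomology
  IsSmoothProjective)

namespace Literature.NumberTheory.Automorphic.Liu2021.Sec41MotivesCMCharacters

universe u

variable {E : Type} [Field E] [NumberField E] [IsCMField E]

/-! ## p. 44 set-up: `I_μ`, `I_1`, `∏_{ι ∈ I} ι(x)` (REAL ∕ DEFINED) -/

/-- **`I_μ`** — «the set of all complex embeddings of `M_μ`» (p. 44 L3), `M_μ = muAlgValueField E μ ⊆ ℂ` the value field of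
`μ^{alg}` (§4.1 p. 41, l. 1928).  REAL. [cite: Liu2021, §4.1 p. 44 L3] -/
abbrev Emb (μ : IdeleClassGroup E →ₜ* Circle) : Type :=
  IdeleClassGroup.muAlgValueField E μ →+* ℂ

/-- The inclusion `M_μ ↪ ℂ` as an element of `I_μ` («`I_1 ⊆ I_μ` is the subset consisting only of the inclusion
`M_μ ↪ ℂ`», p. 44 L15).  DEFINED. [cite: Liu2021, §4.1 p. 44 L15] -/
def inclusionEmb (μ : IdeleClassGroup E →ₜ* Circle) : Emb μ :=
  (IdeleClassGroup.muAlgValueField E μ).subtype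

/-- **`I_1 = {M_μ ↪ ℂ}`** (p. 44 L15).  DEFINED. [cite: Liu2021, §4.1 p. 44 L15] -/
def I₁ (μ : IdeleClassGroup E →ₜ* Circle) : Finset (Emb μ) :=
  {inclusionEmb μ}

/-- **`∏_{ι ∈ I} ι(x)`** for a finite set `I ⊆ I_μ` of complex embeddings of `M_μ` and `x ∈ M_μ` (p. 44 L9, Def. 4.8).
DEFINED. [cite: Liu2021, §4.1 p. 44 L9 and Def. 4.8 (p. 44)] -/
def eigenvalue {μ : IdeleClassGroup E →ₜ* Circle} (I : Finset (Emb μ))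
    (x : IdeleClassGroup.muAlgValueField E μ) : ℂ :=
  ∏ ι ∈ I, ι x

/-- **`[M_μ : ℚ]`** (`= 2 dim A_μ`), the integer indexing the cohomological degrees `H^{[M_μ:ℚ]-i}` on p. 44.  DEFINED.
[cite: Liu2021, §4.1 p. 44 L6] -/
def degree (μ : IdeleClassGroup E →ₜ* Circle) : ℕ :=
  Module.finrank ℚ (IdeleClassGroup.muAlgValueField E μ)

/-! ## The datum of pp. 44–45 (REAL `(A_μ, i_μ)`, REAL Betti cohomology, the tree's Chow calculus + ⟨CARRIER⟩s), in print order -/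

/-- **`H^j_{B,τ'}(A, ℂ)`** for an abelian variety `A / E`, an embedding `τ' : E → ℂ` and `j ∈ ℕ` — REAL: the tree's rational Betti
cohomology `H^j(A(ℂ)_{τ'}; ℚ)` of the complex points of `A` along `τ'` (★ `Motives.bettiCohomology`, for the `E`-algebra structure
`τ'` on `ℂ`, Mathlib `RingHom.toAlgebra` — the house pattern of ★ `AppendixC.algebraAlong`), with coefficients extended to `ℂ`
(`ℂ ⊗_ℚ −`), bundled as a `ModuleCat ℂ` object.  (ED.2: replaces the former ⟨CARRIER⟩ field `ProjectorData.HB`.)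
[cite: Liu2021, §4.1 p. 44 L6 («`H^{[M_μ:ℚ]-i}_{B,τ'}(A_μ, ℂ)`»)] -/
def bettiC (A : AbelianVariety E) (τ' : E →+* ℂ) (j : ℕ) : ModuleCat.{0} ℂ :=
  letI : Algebra E ℂ := τ'.toAlgebra
  ModuleCat.of ℂ (TensorProduct ℚ ℂ (bettiCohomology A.X j))

/-- **`t ↦ ℂ ⊗ (cl_{B,τ'}(t))_*|_{H^j}`** — REAL over a Betti–Hodge realisation datum `B` along `τ'` (★ `Motives.BettiHodgeData`):
the degree-`(j, j)` component of the tree's cycle-class realisation `ρ(t) = γ_ℚ(t)_*` of a correspondence `t ∈ CH_g(A × A)_ℚ`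
(★ `WeilCohomology.realize`, `g = dim A`, `A` smooth projective by the tree's PROVED ★ `AbelianVariety.isSmoothProjective_holds`),
transported to `H^j(A(ℂ)_{τ'}; ℚ)` along `B.isoObj` and tensored with `ℂ`.  Used to PIN `ProjectorData.clB`: Liu's `cl^*_{B,τ'}(t)`
is `ρ(ᵗt)` (Kleiman 1968 §1.3: `γ(ᵗΓ_φ)` induces `φ^*`, ★ `Realisation.isInducedBy_corrClass_transpose_graph`).
[cite: Liu2021, §4.1 p. 44 L8 («`cl^*_{B,τ'}(⟨x⟩)`»)] -/
def bettiOpC (A : AbelianVariety E) (τ' : E →+* ℂ) (B : @BettiHodgeData E _ τ'.toAlgebra) (j : ℕ)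
    (t : Corr A.X A.X A.dim) : Module.End ℂ (bettiC A τ' j) :=
  letI : Algebra E ℂ := τ'.toAlgebra
  LinearMap.baseChange ℂ
    ((B.isoObj A.X j).toLinearMap ∘ₗ
      (B.W.realize (nX := A.dim) (nY := A.dim) (c := A.dim) (e := A.dim)
          (AbelianVariety.isSmoothProjective_holds : IsSmoothProjective A.dim A.X)
          (AbelianVariety.isSmoothProjective_holds : IsSmoothProjective A.dim A.X) rfl t j j) ∘ₗ
        (B.isoObj A.X j).symm.toLinearMap)

/-- The `ℚ`-linear inclusion `M_μ ⊆ ℂ` (`M_μ = muAlgValueField E μ`, a subfield of `ℂ`), used to say «coefficients in `M_μ`».  REAL.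
[cite: Liu2021, §4.1 p. 44 L–1 («`CH^{[M_μ:ℚ]/2}(A_μ × A_μ)_{M_μ}`»)] -/
def inclQ (μ : IdeleClassGroup E →ₜ* Circle) : IdeleClassGroup.muAlgValueField E μ →ₗ[ℚ] ℂ :=
  ((IdeleClassGroup.muAlgValueField E μ).subtype.toRatAlgHom).toLinearMap

/-- **The data of [Liu2021, §4.1 pp. 44–45]** for «`μ` as in Definition 4.5» (conjugate symplectic of weight one: `hμ`, `hw`)
and a chosen CM datum `D_μ ∈ 𝒜(μ)` («We take a CM data `D_μ = (A_μ, i_μ, λ_μ, r_μ) ∈ 𝒜(μ)` for `μ`», p. 44 L3): the REAL pair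
`(A_μ, i_μ)` (= `Liu2021.Def45.CMDatum.A ∕ .i ∕ .finrank_eq`), the tree's calculus of Chow correspondences over `E`
(★ `Motives.ChowCorrespondences`, a hypothesis structure the tree's consumers take as a parameter) and a Betti–Hodge realisation
datum along every `τ' : E → ℂ` (★ `Motives.BettiHodgeData`) compatible with it (★ `ChowCorrespondences.Realisation`), and the
⟨CARRIER⟩s listed in the module docstring («The typing»): the `ℂ`-algebra `CH^{[M_μ:ℚ]/2}(A_μ × A_μ)_ℂ` PINNED to the REAL
`ℂ ⊗_ℚ CH_g(A_μ × A_μ)_ℚ` (★ `Motives.Corr A.X A.X g`, `g = dim A_μ = [M_μ:ℚ]/2`) with its composition and unit, its `M_μ`-rational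
subring PINNED as the image of `M_μ ⊗_ℚ CH_g(A_μ × A_μ)_ℚ`, the numerically trivial classes, O'Sullivan's symmetrically
distinguished classes with his canonical lift, and the action `cl^*_{B,τ'}` on the REAL `H^j_{B,τ'}(A_μ, ℂ)` (`bettiC`) PINNED to the
tree's cycle-class realisation (`bettiOpC`).  Nothing printed as a theorem is a field: the `canLift_*` ∕ `symmDist_*` fields are the
MEANING of «the main theorem of [O'S11] … canonical lift … with coefficients in `M_μ`» (p. 45 L4–7 with footnote 4), `smul_mem` ∕
`coe_ChowM` the meaning of «`CH(…)_{M_μ}`».  A hypothesis carrier: nothing is asserted.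
ED.2 (squad TL retro-audit, T-ref2 (c) P1∕P2): `HB` and `corr` are now REAL definitions (`ProjectorData.HB`, `ProjectorData.corr`
below); new fields `CC`, `betti`, `realisation`, `ofCorr` (+ `_bijective`, `_mul`, `_one`), `coe_ChowM`, `clB_ofCorr`, `symmDist`
(+ `canLift_mem_symmDist`, `symmDist_unique`, `mul_mem_symmDist`, `one_mem_symmDist`); `clB` is `ℂ`-LINEAR in `t` (its
(anti-)multiplicativity is a consequence of `realisation`, ★ `Realisation.realize_comp`, and is not posited); all item predicates
below are byte-identical.
[cite: Liu2021, §4.1 pp. 44–45 (TeX ll. 2000–2031)] -/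
structure ProjectorData {μ : IdeleClassGroup E →ₜ* Circle} (hμ : IdeleClassGroup.IsConjugateSymplectic E μ)
    (hw : IdeleClassGroup.HasWeight E μ 1) : Type 2 where
  /-- «`A_μ` is an abelian variety over `E`» (Def. 4.5 (2), p. 42) — REAL (`Def45.CMDatum.A`). -/
  A : AbelianVariety E
  /-- «`i_μ : M_μ → End_E(A_μ)_ℚ` is a CM structure» (Def. 4.5 (2), p. 42) — REAL (`Def45.CMDatum.i`). -/
  i : IdeleClassGroup.muAlgValueField E μ →+* A.endAlgebra
  /-- «is a CM structure»: `[M_μ : ℚ] = 2 dim A_μ` (`Def45.CMDatum.finrank_eq`, READING I1-R3 there). -/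
  finrank_eq : degree μ = 2 * A.dim
  /-- The calculus of Chow correspondences between smooth projective `E`-varieties (composition, transpose, graphs; Fulton §16.1)
  — the tree's hypothesis structure ★ `Motives.ChowCorrespondences E`, taken as a datum exactly as its docstring prescribes
  («consumers take `(C : ChowCorrespondences k)` as a parameter»).  ED.2. -/
  CC : ChowCorrespondences E
  /-- For every «`τ' : E ↪ ℂ`» (p. 44 L6) a Betti–Hodge realisation datum of `E`-varieties along `τ'` — the tree's hypothesis
  structure ★ `Motives.BettiHodgeData E` for the `E`-algebra structure `τ'` on `ℂ` (a Weil cohomology `W` with `W(X) ≅ H^•(X(ℂ)_{τ'}; ℚ)`,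
  cycle classes, Hodge structures).  ED.2. -/
  betti : ∀ τ' : E →+* ℂ, @BettiHodgeData E _ τ'.toAlgebra
  /-- The cycle class on products is compatible with the calculus `CC` («the cohomological shadow», ★ `ChowCorrespondences.Realisation`:
  `γ(g ∘ f) = γ(g) ∘ γ(f)`, `γ(ᵗf) = σ^* γ(f)`, `γ(ᵗΓ_φ)` induces `φ^*`), for every `τ'`.  ED.2. -/
  realisation : ∀ τ' : E →+* ℂ, letI : Algebra E ℂ := τ'.toAlgebra; CC.Realisation (betti τ').W
  /-- ⟨CARRIER⟩ `CH^{[M_μ:ℚ]/2}(A_μ × A_μ)_ℂ` as a `ℂ`-algebra (composition of correspondences, unit `[Δ]`; p. 44, Def. 4.8 (2)) — its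
  `ℂ`-module and ring structure are PINNED by `ofCorr`, `ofCorr_bijective`, `ofCorr_mul`, `ofCorr_one` below (bundled as an `AlgCat`
  object so that no instance is declared in this file). -/
  Chow : AlgCat.{0} ℂ
  /-- PIN (ED.2): the `ℂ`-linear identification `ℂ ⊗_ℚ CH_g(A_μ × A_μ)_ℚ → CH^{[M_μ:ℚ]/2}(A_μ × A_μ)_ℂ` with the REAL rational Chow group of
  `g`-cycles (`g = dim A_μ`, i.e. codimension `g = [M_μ:ℚ]/2` on the `2g`-dimensional `A_μ × A_μ`, `finrank_eq`) ★ `Motives.Corr A.X A.X g`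
  («Chow groups with coefficients in a field» = `⊗` that field) … -/
  ofCorr : TensorProduct ℚ ℂ (Corr A.X A.X A.dim) →ₗ[ℂ] Chow
  /-- … which is bijective (so `Chow` IS `CH_g(A_μ × A_μ)_ℚ ⊗ ℂ` as a `ℂ`-vector space) … -/
  ofCorr_bijective : Function.Bijective ofCorr
  /-- … multiplicative for the composition of correspondences `t ∘ s` of the calculus `CC` (Fulton Def. 16.1.1 ∕ Cor. 16.1.1: «an
  associative ring with unit `[Δ_X]`»; the product of `Chow` is `t * s = t ∘ s`, ★ `ChowCorrespondences.comp`, degrees `g + g = g + g`) … -/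
  ofCorr_mul : ∀ t s : Corr A.X A.X A.dim,
    ofCorr (TensorProduct.tmul ℚ (1 : ℂ) (CC.comp A.dim rfl t s)) =
      ofCorr (TensorProduct.tmul ℚ (1 : ℂ) t) * ofCorr (TensorProduct.tmul ℚ (1 : ℂ) s)
  /-- … and unital: `[Δ_{A_μ}] ↦ 1` (★ `ChowCorrespondences.diag`). -/
  ofCorr_one : ofCorr (TensorProduct.tmul ℚ (1 : ℂ) (CC.diag A.dim A.X)) = 1
  /-- ⟨CARRIER⟩ `CH^{[M_μ:ℚ]/2}(A_μ × A_μ)_{M_μ} ⊆ CH^{[M_μ:ℚ]/2}(A_μ × A_μ)_ℂ` (p. 44 L–1, Def. 4.9), a subring … -/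
  ChowM : Subring Chow
  /-- … stable under the scalars `M_μ ⊆ ℂ` (the meaning of the coefficient ring `M_μ`) … -/
  smul_mem : ∀ (a : IdeleClassGroup.muAlgValueField E μ) (t : Chow), t ∈ ChowM → ((a : ℂ) • t) ∈ ChowM
  /-- … PINNED (ED.2) as the image of `M_μ ⊗_ℚ CH_g(A_μ × A_μ)_ℚ` under `ofCorr ∘ (M_μ ⊆ ℂ) ⊗ id` (coefficient extension along
  `M_μ ⊆ ℂ`, `inclQ`). -/
  coe_ChowM : (ChowM : Set Chow) =
    Set.range (fun s : TensorProduct ℚ (IdeleClassGroup.muAlgValueField E μ) (Corr A.X A.X A.dim) =>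
      ofCorr (LinearMap.rTensor (Corr A.X A.X A.dim) (inclQ μ) s))
  /-- ⟨CARRIER⟩ the classes in `CH^{[M_μ:ℚ]/2}(A_μ × A_μ)_ℂ` that are numerically equivalent to zero («the numerical
  equivalence class of `𝕋_μ^x`», p. 45 L2).  Not REAL-definable here: numerical equivalence needs the degree of `0`-cycles and the
  intersection product on `A_μ × A_μ` (Fulton Def. 19.1), neither of which ★ `ChowCorrespondences` offers. -/
  numTrivial : Submodule ℂ Chow
  /-- ⟨CARRIER⟩ (ED.2, O'Sullivan's notion) the `ℂ`-span of the **symmetrically distinguished** classes in `CH^g(A_μ × A_μ)_ℚ`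
  ([OSullivan2011], Introduction: `α` is symmetrically distinguished if for every `m` the projection `CH(A^m)_ℚ → \overline{CH}(A^m)_ℚ`
  is injective on the space `V_m(α)` generated from `α` by the algebraic operations, pull-backs and push-forwards along homomorphisms
  `A^n → A^m` — for the abelian variety `A_μ × A_μ`; any field of characteristic `0` as coefficients by [OSullivan2011, Cor. 6.2.6],
  Liu's footnote 4).  Not constructible in the tree (Chow rings of all powers). -/
  symmDist : Submodule ℂ Chow
  /-- ⟨CARRIER⟩ «the main theorem of [O'S11] … to `A_μ × A_μ`»: `t ↦` the canonical (symmetrically distinguished) cycle in the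
  numerical equivalence class of `t` (p. 45 L4–7). -/
  canLift : Chow → Chow
  /-- `canLift t` is a LIFT of the numerical class of `t` (p. 45 L5 «has a canonical lift»; [OSullivan2011] Theorem, first bullet:
  «Above every cycle in `\overline{CH}^i(A)_ℚ` there lies a … symmetrically distinguished cycle in `CH^i(A)_ℚ`»). -/
  canLift_sub_mem : ∀ t : Chow, canLift t - t ∈ numTrivial
  /-- `canLift t` depends only on the numerical class of `t` (p. 45 L5). -/
  canLift_eq_of_sub_mem : ∀ t t' : Chow, t - t' ∈ numTrivial → canLift t = canLift t'
  /-- the lift of an `M_μ`-rational class is `M_μ`-rational (p. 45 L6 «in `CH^{[M_μ:ℚ]/2}(A_μ × A_μ)_{M_μ}`»; footnote 4: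
  [O'S11, Cor. 6.2.6]). -/
  canLift_mem : ∀ t : Chow, t ∈ ChowM → canLift t ∈ ChowM
  /-- PIN (ED.2): the canonical lift IS symmetrically distinguished ([OSullivan2011] Theorem, first bullet). -/
  canLift_mem_symmDist : ∀ t : Chow, canLift t ∈ symmDist
  /-- PIN (ED.2): «Above every cycle in `\overline{CH}^i(A)_ℚ` there lies a UNIQUE symmetrically distinguished cycle»
  ([OSullivan2011] Theorem, first bullet; Thm. 6.2.5): two symmetrically distinguished classes in one numerical class are equal. -/
  symmDist_unique : ∀ s s' : Chow, s ∈ symmDist → s' ∈ symmDist → s - s' ∈ numTrivial → s = s'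
  /-- PIN (ED.2): symmetrically distinguished classes are closed under the composition of correspondences ([OSullivan2011] Theorem,
  second and third bullets — «the product of symmetrically distinguished cycles … is symmetrically distinguished», «for any
  homomorphism of abelian varieties `f : A → A'`, the pullback `f^*` and push forward `f_*` along `f` preserve symmetrically
  distinguished cycles» — applied to `t ∘ s = p_{13*}(p_{12}^* s · p_{23}^* t)`, the `p_{ij} : A_μ^3 → A_μ^2` being homomorphisms). -/
  mul_mem_symmDist : ∀ s t : Chow, s ∈ symmDist → t ∈ symmDist → s * t ∈ symmDist
  /-- PIN (ED.2): `[Δ_{A_μ}] = (id, id)_*[A_μ]` is symmetrically distinguished (third bullet applied to the fundamental class). -/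
  one_mem_symmDist : (1 : Chow) ∈ symmDist
  /-- ⟨CARRIER⟩ `t ↦ cl^*_{B,τ'}(t) | H^j_{B,τ'}(A_μ, ℂ)`: the action of (the Betti cycle class of) a degree-`0` self-correspondence on the
  REAL `H^j_{B,τ'}(A_μ, ℂ) = bettiC A τ' j` (p. 44 L8 «the subspace on which `cl^*_{B,τ'}(⟨x⟩)` acts»; «`⟨x⟩^* = i_μ(x)_*`», L5),
  `ℂ`-linear in `t`; its VALUES are pinned by `clB_ofCorr`. -/
  clB : ∀ (τ' : E →+* ℂ) (j : ℕ), Chow →ₗ[ℂ] Module.End ℂ (bettiC A τ' j)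
  /-- PIN (ED.2): on a rational class `t ∈ CH_g(A_μ × A_μ)_ℚ`, `cl^*_{B,τ'}(t)|_{H^j} = ℂ ⊗ ρ_{τ'}(ᵗt)_{j,j}` — the tree's cycle-class
  realisation of the transpose (★ `WeilCohomology.realize`, ★ `ChowCorrespondences.transpose`; `u^* = (ᵗu)_*`, Fulton §16.1), read on
  `H^j(A_μ(ℂ)_{τ'}; ℚ)` through `(betti τ').isoObj` (`bettiOpC`). -/
  clB_ofCorr : ∀ (τ' : E →+* ℂ) (j : ℕ) (t : Corr A.X A.X A.dim),
    clB τ' j (ofCorr (TensorProduct.tmul ℚ (1 : ℂ) t)) = bettiOpC A τ' (betti τ') j (CC.transpose A.dim t)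

namespace ProjectorData

variable {μ : IdeleClassGroup E →ₜ* Circle} {hμ : IdeleClassGroup.IsConjugateSymplectic E μ}
  {hw : IdeleClassGroup.HasWeight E μ 1} (D : ProjectorData hμ hw)

/-- **`H^j_{B,τ'}(A_μ, ℂ)`**, «the Betti cohomology of `A_μ ⊗_{E,τ'} ℂ` with complex coefficients» for every «`τ' : E ↪ ℂ`» (p. 44 L6) —
REAL: `bettiC D.A τ' j = ℂ ⊗_ℚ H^j(A_μ(ℂ)_{τ'}; ℚ)` (ED.2: formerly a ⟨CARRIER⟩ field of the same name and type).
[cite: Liu2021, §4.1 p. 44 L6] -/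
abbrev HB (τ' : E →+* ℂ) (j : ℕ) : ModuleCat.{0} ℂ :=
  bettiC D.A τ' j

/-- **`f ↦` the class of the correspondence `A_μ ←f− A_μ −id→ A_μ`** (p. 44 L4–5, used in print for `f = i_μ(x)`: `⟨x⟩ = corr f`) —
REAL over the datum (ED.2: formerly a ⟨CARRIER⟩ field): the span `(f, id)` pushes `[A_μ]` to the cycle `{(f a, a)} = ᵗΓ_f`, the
TRANSPOSE of the graph of `f` (Fulton Def. 16.1.1; ★ `ChowCorrespondences.graph`, `.transpose`, on the `E`-scheme morphism
underlying `f`), read in `CH^{[M_μ:ℚ]/2}(A_μ × A_μ)_ℂ` through `ofCorr`; then `⟨x⟩^* = (Γ_{i_μ(x)})_* = i_μ(x)_*` as printed (L5).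
[cite: Liu2021, §4.1 p. 44 L4–5] -/
def corr (f : CategoryTheory.End D.A) : D.Chow :=
  D.ofCorr (TensorProduct.tmul ℚ (1 : ℂ) (D.CC.transpose D.A.dim (D.CC.graph D.A.dim f.hom.hom.hom)))

/-- «`x ∈ M_μ` such that `i_μ(x) ∈ End_E(A_μ)`» (p. 44 L4; Def. 4.8 (1) «with `i_μ(x) ∈ End_E(A_μ)`»): an element of `M_μ`
TOGETHER WITH the endomorphism `f = i_μ(x) ∈ End_E(A_μ)` (`i_μ(x) = 1 ⊗ f` in `End⁰(A_μ) = ℚ ⊗ End(A_μ)`).  REAL.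
[cite: Liu2021, §4.1 p. 44 L4 and Def. 4.8 (1) (p. 44)] -/
structure IntegralElement where
  /-- the element `x ∈ M_μ` -/
  x : IdeleClassGroup.muAlgValueField E μ
  /-- `i_μ(x)` as an honest endomorphism of `A_μ` -/
  f : CategoryTheory.End D.A
  /-- `i_μ(x) = 1 ⊗ f` -/
  i_eq : D.i x = AbelianVariety.endAlgebra.of D.A f

/-- **`⟨x⟩`** — «the correspondence `A_μ ←(i_μ(x))− A_μ −(id)→ A_μ` of `A_μ`» for `x` with `i_μ(x) ∈ End_E(A_μ)` (p. 44 L4–5).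
DEFINED (through the ⟨CARRIER⟩ `corr`). [cite: Liu2021, §4.1 p. 44 L4–5] -/
def corrOf (p : D.IntegralElement) : D.Chow :=
  D.corr p.f

/-- **`H^j_{B,τ'}(A_μ, ℂ)_I`** — «the subspace on which `cl^*_{B,τ'}(⟨x⟩)` acts by `∏_{ι∈I} ι(x)` for every `x ∈ M_μ` satisfying
`i_μ(x) ∈ End_E(A_μ)`» (p. 44 L8–10), READING R1: the intersection over all integral `x` of the `∏_{ι∈I} ι(x)`-eigenspaces
(Mathlib `Module.End.eigenspace`).  DEFINED. [cite: Liu2021, §4.1 p. 44 L8–10] -/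
def eigenPiece (τ' : E →+* ℂ) (j : ℕ) (I : Finset (Emb μ)) : Submodule ℂ (D.HB τ' j) :=
  ⨅ p : D.IntegralElement, Module.End.eigenspace (D.clB τ' j (D.corrOf p)) (eigenvalue I p.x)

/-- **[Liu2021, p. 44 L6–8] «For every `τ' : E ↪ ℂ` and every integer `0 ≤ i ≤ [M_μ:ℚ]`, we have a canonical decomposition
`H^{[M_μ:ℚ]-i}_{B,τ'}(A_μ, ℂ) = ⊕_{I ⊆ I_μ, |I| = i} H^{[M_μ:ℚ]-i}_{B,τ'}(A_μ, ℂ)_I`»** — typed as: the family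
`(H_I)_{|I| = i}` of subspaces of `H^{[M_μ:ℚ]-i}` is independent (`iSupIndep`) and spans.  Named fact (unnumbered printed
claim), a predicate on the datum; NO PROOF. [cite: Liu2021, §4.1 p. 44 L6–8] -/
def BettiDecomposition : Prop :=
  ∀ (τ' : E →+* ℂ) (i : ℕ), i ≤ degree μ →
    iSupIndep (fun I : {I : Finset (Emb μ) // I.card = i} => D.eigenPiece τ' (degree μ - i) I.1) ∧
      (⨆ I : {I : Finset (Emb μ) // I.card = i}, D.eigenPiece τ' (degree μ - i) I.1) = ⊤

/-- **`𝕋_μ^{B,τ'}`** (p. 44 L11–15), as a predicate on a degree-preserving endomorphism `T = (T_j)_j` of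
`⊕_j H^j_{B,τ'}(A_μ, ℂ)`: «• the restriction `𝕋_μ^{B,τ'} | H^i_{B,τ'}(A_μ, ℂ)` is zero if `i ≠ [M_μ:ℚ] − 1`, • the restriction
`𝕋_μ^{B,τ'} | H^{[M_μ:ℚ]-1}_{B,τ'}(A_μ, ℂ)` is the canonical projection to the direct summand `H^{[M_μ:ℚ]-1}_{B,τ'}(A_μ, ℂ)_{I_1}`»
(READING R3: identity on `H_{I_1}`, zero on the other summands `H_I`, `|I| = 1`).  DEFINED.
[cite: Liu2021, §4.1 p. 44 L11–15] -/
def IsTB (τ' : E →+* ℂ) (T : ∀ j : ℕ, Module.End ℂ (D.HB τ' j)) : Prop :=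
  (∀ j : ℕ, j ≠ degree μ - 1 → T j = 0) ∧
    (∀ v ∈ D.eigenPiece τ' (degree μ - 1) (I₁ μ), T (degree μ - 1) v = v) ∧
      ∀ I : Finset (Emb μ), I.card = 1 → I ≠ I₁ μ →
        ∀ v ∈ D.eigenPiece τ' (degree μ - 1) I, T (degree μ - 1) v = 0

/-! ## Definition 4.8 (p. 44; TeX `de:generator`, ll. 2011–2026) -/

/-- **[Liu2021, Def. 4.8 (1)] «We say that `x ∈ M_μ` is an *`I`-generator* if `x` generates the field `M_μ` with
`i_μ(x) ∈ End_E(A_μ)` such that `∏_{ι∈I} ι(x) ≠ ∏_{ι∈J} ι(x)` for every `J ⊆ I_μ` other than `I`»** (p. 44), for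
`I ⊆ I_μ` finite (all of `I_μ` is finite) and `x` given with its endomorphism (`IntegralElement`); READING R2
(`ℚ(x) = M_μ`).  DEFINED. [cite: Liu2021, Def. 4.8 (1) (p. 44)] -/
def IsGenerator (I : Finset (Emb μ)) (p : D.IntegralElement) : Prop :=
  IntermediateField.adjoin ℚ ({p.x} : Set (IdeleClassGroup.muAlgValueField E μ)) = ⊤ ∧
    ∀ J : Finset (Emb μ), J ≠ I → eigenvalue I p.x ≠ eigenvalue J p.x

end ProjectorData

/-- The interpolation polynomial of Def. 4.8 (2): `P_I^x(t) := ∏_{J ⊆ I_μ, J ≠ I} (λ_I − λ_J)⁻¹ · (t − λ_J) ∈ ℂ[t]`,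
`λ_J = ∏_{ι∈J} ι(x)` — the printed product `∏_{J≠I} (⟨x⟩ − λ_J)⁄(λ_I − λ_J)` of pairwise commuting factors is `P_I^x(⟨x⟩)`.
(`I_μ` is finite: `M_μ` is a number field, `hμ.numberField_muAlgValueField`; the filter `J ≠ I` uses classical decidability.)  DEFINED.
[cite: Liu2021, Def. 4.8 (2) (p. 44)] -/
def interpPoly {μ : IdeleClassGroup E →ₜ* Circle} (hμ : IdeleClassGroup.IsConjugateSymplectic E μ)
    (I : Finset (Emb μ)) (x : IdeleClassGroup.muAlgValueField E μ) : Polynomial ℂ :=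
  haveI : NumberField (IdeleClassGroup.muAlgValueField E μ) := hμ.numberField_muAlgValueField
  haveI : DecidableEq (Emb μ) := Classical.decEq _
  ∏ J ∈ (Finset.univ : Finset (Finset (Emb μ))).filter (fun J => J ≠ I),
    Polynomial.C (eigenvalue I x - eigenvalue J x)⁻¹ * (Polynomial.X - Polynomial.C (eigenvalue J x))

namespace ProjectorData

variable {μ : IdeleClassGroup E →ₜ* Circle} {hμ : IdeleClassGroup.IsConjugateSymplectic E μ}
  {hw : IdeleClassGroup.HasWeight E μ 1} (D : ProjectorData hμ hw)

/-- **[Liu2021, Def. 4.8 (2)] «For an `I`-generator `x`, we put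
`𝕋^x_μ := ∏_{J ≠ I} (⟨x⟩ − ∏_{ι∈J} ι(x)) ⁄ (∏_{ι∈I} ι(x) − ∏_{ι∈J} ι(x)) ∈ CH^{[M_μ:ℚ]/2}(A_μ × A_μ)_ℂ`»** (p. 44): the
evaluation of `interpPoly hμ I x` at `⟨x⟩` in the `ℂ`-algebra `CH^{[M_μ:ℚ]/2}(A_μ × A_μ)_ℂ` (`Polynomial.aeval`).  Defined for
every integral `x` (its use is for `I`-generators).  DEFINED. [cite: Liu2021, Def. 4.8 (2) (p. 44)] -/
def Tx (I : Finset (Emb μ)) (p : D.IntegralElement) : D.Chow :=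
  Polynomial.aeval (D.corrOf p) (interpPoly hμ I p.x)

/-! ## The claims of p. 44 L–1 – p. 45 L7 (TeX l. 2029), named facts -/

/-- **«We now choose an `I_1`-generator `x`»** (p. 44 last line): the existence of an `I_1`-generator, implicit in print
(made explicit so that the facts below are not vacuous).  Named fact; NO PROOF. [cite: Liu2021, §4.1 p. 44 L–1] -/
def GeneratorExists : Prop :=
  ∃ p : D.IntegralElement, D.IsGenerator (I₁ μ) p

/-- **[Liu2021, p. 44 L–1] «It is easy to see that `𝕋_μ^x` lies in `CH^{[M_μ:ℚ]/2}(A_μ × A_μ)_{M_μ}`»** for an `I_1`-generator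
`x`.  Named fact (predicate on the datum); NO PROOF. [cite: Liu2021, §4.1 p. 44 L–1 – p. 45 L1] -/
def TxRational : Prop :=
  ∀ p : D.IntegralElement, D.IsGenerator (I₁ μ) p → D.Tx (I₁ μ) p ∈ D.ChowM

/-- **[Liu2021, p. 45 L1] «and moreover `cl^*_{B,τ'}(𝕋^x_μ) = 𝕋_μ^{B,τ'}`»** for an `I_1`-generator `x` (and every `τ'`, as in
the set-up).  Named fact; NO PROOF. [cite: Liu2021, §4.1 p. 45 L1] -/
def TxRealisation : Prop :=
  ∀ p : D.IntegralElement, D.IsGenerator (I₁ μ) p →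
    ∀ τ' : E →+* ℂ, D.IsTB τ' (fun j => D.clB τ' j (D.Tx (I₁ μ) p))

/-- **[Liu2021, p. 45 L2–3] «In particular, the numerical equivalence class of `𝕋_μ^x` is independent of the choice of `x`,
which we denote by `𝕋_μ^{num}`»** — for `I_1`-generators `x`, `y`: `𝕋^x_μ − 𝕋^y_μ` is numerically trivial (READING R4).
Named fact; NO PROOF. [cite: Liu2021, §4.1 p. 45 L2–3] -/
def TxNumIndependent : Prop :=
  ∀ p q : D.IntegralElement, D.IsGenerator (I₁ μ) p → D.IsGenerator (I₁ μ) q →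
    D.Tx (I₁ μ) p - D.Tx (I₁ μ) q ∈ D.numTrivial

/-! ## Definition 4.9 (p. 45; TeX `de:mu_canonical`, l. 2032) -/

/-- **`𝕋_μ^{can}`** — «we know that `𝕋_μ^{num}` has a canonical lift in `CH^{[M_μ:ℚ]/2}(A_μ × A_μ)_{M_μ}`, which we denote by
`𝕋_μ^{can}`» (p. 45 L5–7): the O'Sullivan lift of (the numerical class of) `𝕋^x_μ`, for the chosen `I_1`-generator `x`
(READING R4).  DEFINED. [cite: Liu2021, §4.1 p. 45 L4–7 and Def. 4.9 (p. 45)] -/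
def Tcan (p : D.IntegralElement) : D.Chow :=
  D.canLift (D.Tx (I₁ μ) p)

/-- **[Liu2021, Def. 4.9] «We call `𝕋_μ^{can} ∈ CH^{[M_μ:ℚ]/2}(A_μ × A_μ)_{M_μ}` the *canonical projector* of `A_μ`»** (p. 45),
with the well-definedness printed before it (p. 45 L2–7): for every `I_1`-generator `x`, `𝕋^{can}_μ = canLift 𝕋^x_μ` has
coefficients in `M_μ` and does not depend on `x`.  Named fact; NO PROOF. [cite: Liu2021, Def. 4.9 (p. 45)] -/
def Def49AsPrinted : Prop :=
  ∀ p : D.IntegralElement, D.IsGenerator (I₁ μ) p →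
    D.Tcan p ∈ D.ChowM ∧ ∀ q : D.IntegralElement, D.IsGenerator (I₁ μ) q → D.Tcan p = D.Tcan q

/-! ## Lemma 4.10 (p. 45; TeX `le:mu_canonical`, l. 2036) -/

/-- **[Liu2021, Lem. 4.10] «For every `τ' : E ↪ ℂ`, we have `cl^*_{B,τ'}(𝕋_μ^{can}) = 𝕋_μ^{B,τ'}`»** (p. 45), `𝕋^{can}_μ` built
from any `I_1`-generator `x` (Def. 4.9).  Named fact (predicate on the datum; a consumer takes `(h : D.Lem410AsPrinted)` for
its own `D`); NO PROOF (printed proof: p. 45 L10–22, from [O'S11] (iii) and an `I^c`-generator).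
[cite: Liu2021, Lem. 4.10 (p. 45)] -/
def Lem410AsPrinted : Prop :=
  ∀ p : D.IntegralElement, D.IsGenerator (I₁ μ) p →
    ∀ τ' : E →+* ℂ, D.IsTB τ' (fun j => D.clB τ' j (D.Tcan p))

end ProjectorData

end Literature.NumberTheory.Automorphic.Liu2021.Sec41MotivesCMCharacters

end
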